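import Summits.QuantumFields.YangMills.Theorems.BalabanUVNodesN12MinimiserFamilyOfClassThreshold
import HarnessLib

/-!
# BalabanUVNodes ∕ N12 — KNIT LINK #2, EDITION OF RECORD: THE w1 LINEAGE’s (J0′) CHART THEOREM AT `𝐁_k(Z)` OVER THE LANE’s THRESHOLD PRODUCER `N12MinimiserFamilyOfClassThreshold` —
# per base field the consumer supplies ONLY (E) the minimiser, the datum’s scale-`k` regularity on `Z`, the gauge row (δ) (plain, or for a RESIDUAL re-gauging `U₀^σ`) and (T1@q₀)
# ([Balaban1985Variational] Thm 1 p. 279, (3)–(4),(7) pp. 277–278, Sect. C (44)–(48) p. 285, (81)–(83) p. 290, Sect. G pp. 305–307, (181) p. 307; [Balaban1989LargeFieldI] (1.74) p. 192,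
# Prop. 1 p. 194; [Balaban1989LargeFieldII] p. 357, (1.7)–(1.9) p. 358, (1.12)–(1.13) p. 359; [Balaban1988Convergent] (2.2) p. 255, (2.10)–(2.13) pp. 256–257; [Balaban1985Averaging]
# (122)–(126) p. 36; [Balaban1987RG1] (0.4) p. 253)

Cell `pub-ymgap` (HUMAN RULINGS D-0062 ∕ D-0149), seat `pub-ymgap-dag-n12-d` g24 (R134 N12 [B15] s2 = by-name knit at the record; census item E1 = the (J0′) row); count-neutral helper of K1⁹
`stmt-QuantumFields-27364` (`--kind proof --supports … --as helper`).  THEOREMS ONLY (0 `def`, 0 `instance`, 0 `sorry`); four compositions BY NAME, nothing modified.  THIRD SIBLING of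
`N12MinimiserFamilyAtRecordBjTower` (p710140, over the capstone (O): per base field (E) + datum + (β) + (T1@q₀)) and `N12MinimiserFamilyAtRecordBjTowerNearFlat` (p713556, over (O′): (β)
split into (δ) + (P) + (M)): THIS FILE is the same composition over the lane's producer OF RECORD `N12MinimiserFamilyOfClassThreshold` (dag-n12-c g26, V4), in which EVERY analytic letter
is discharged inside — [15] (45) in velocity currency (dag-n12-w6 g11 `N12HVelocityOfClass`), the slice action `a` and the slice datum coordinates `Φ₀` (defined by their formulas), the flat
coercivity and the (L) road ((P) — `B15Prop1FlatCoerciveSplit` + the lane's per-bond (L) inhabitant), the multiplier row (M) (dag-n12-w6 g14 `N12MultiplierLetterOfClass` fed the lane's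
(R2) chart-curvature letter `N12SliceDatumCurvatureOfClass`), the tower-flatness (δ_T) (`B15Prop1TowerFlatOfNearFlat`) — and ONE gauge-tolerance threshold `δ₀ > 0` is ANNOUNCED per
(instance, height) before the base fields.  As in the siblings, the class facts (dag-n12-w1 g4 `classLetters_closure_regMSCoPOfRecord_Bj`: `reg′ := closure` of NODE 00's (2.12) class,
closed, the constrained averages continuous on it) and ONE rooted forest with its axial slice (dag-n12-w3 `exists_forest_slice_Bj`: (F1), (F2), (TREE), (F3)) are discharged BY NAME, and
V4's displayed `0 < ρ″` follows from the floor.  Per base field the consumer supplies EXACTLY: (E) `IsMinimizer`; the datum's scale-`k` regularity on `Z`; (δ) — `U₀` bondwise `δc`-flat on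
the plaquettes meeting a bond sourced in `Ω₁(Z)` (§1 ∕ §3), or a RESIDUAL gauge `σ` (scale-`j` images `1` at both ends of every constrained bond) with (δ) for `U₀^σ` (§2 ∕ §4 — exactly
the output shape of dag-n12-w3's (σ)_N producer `N12GaugeLetterLocOfClass.exists_gaugeLetterLoc_atRecord_of_class`); (T1@q₀) over the closure of the class.  Two shapes each: compact-`K`
(V4's own) and the CLOSED small-field guard `{∀ p ∈ G, |V_k(∂p) − 1| ≤ eR}` read once (`K :=` the guard itself, compact by `B15Prop1ClosedGuardUniformRadius.isCompact_setOf_plaqLeOn` —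
the shape the knit-row junction `N12MinimiserFamilyKnitRowThreshold` consumes at `G := plaqsInside (pts k (Z ∩ Λᶜ))`; no `hMinC` detour since `δ₀` is announced under `K`).

HONEST FRAMING ∕ LOCATED.  Compositions by name + four lines of arithmetic (`0 < ρ″`); (E), the datum row, (δ)∕(σ,δ), (T1@q₀) and the per-height letters stay DISPLAYED — (E)∕(T1@q₀) are
[15] Thm 1's existence ∕ uniqueness rows (NODE 00 ∕ N07 ∕ b11 currencies), (δ) is a GAUGE letter (bondwise near-flatness after a residual normalisation — the direct road's (N)-package
clause; dag-n12-c's LOCATED-GEOM v3 for the shape coverage); `δ₀`, `R` and every per-height letter are EXISTENCE constants per (instance, height) (census U4; print's volume-uniform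
(46)∕(83) and `k`-uniformity NOT claimed); nothing of Bałaban's estimates asserted; N12 NOT discharged; K1⁹ NOT closed; counts unmoved; one finite 𝕋⁴ programme at fixed `ε = L^{-K}` —
R4 closes the conditional rung `BalabanLadder.UV` only; no summit statement is proved here and NOT the Yang–Mills mass gap (Clay); nothing continuum ∕ ℝ⁴ ∕ OS.
-/

noncomputable section

namespace Summit.QuantumFields.YangMills.BalabanUVNodes.N12MinimiserFamilyAtRecordBjTowerThreshold

open scoped BigOperators Matrix.Norms.L2Operator Topology
open Literature.MathematicalPhysics.QuantumFieldTheory.Balaban1983to89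
open T4Continuum
open B15DeterminingSets GaugeField
open ExpMeanLog (expMeanLogSU deltaSU)
open T4AdjointCovarianceUnitary (lieSU)
open Node00
open B15SU2ChartHolomorphic (genE)
open B15Prop1AnalyticExtClause (cplxVec)
open B15Prop1ChartCalculusSU2 (E3)
open T4CubeChartGnomonic (SU2)
open B14.Eq213DetSet (Bj maxDomT Bj_of_gt)
open B14.Eq213MaximalDomains (side)
open B14.Eq22Determines (IsBlockUnion)
open B14.Eq216Concrete (feeds)
open B5Eq118OneStroke (iterBlockOf)
open B15Eq112TorusCover (lift)
open T4AxialGaugeSmallField (boxPlaqs)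
open B15Prop1Carrier (plaqsInside)
open Summit.QuantumFields.YangMills.BalabanUVNodes.N12ClassLetterGeometryOfRecord (classLetters_closure_regMSCoPOfRecord_Bj)
open Summit.QuantumFields.YangMills.BalabanUVNodes.N12ForestSlice (exists_forest_slice_Bj)
open Summit.QuantumFields.YangMills.BalabanUVNodes.N12MinimiserFamilyOfClassThreshold (hMin_atRecord_of_node00Letters_thm1AtBase_central_ofClass_threshold
  hMin_atRecord_of_node00Letters_thm1AtBase_central_ofClass_threshold_residual)
open Literature.MathematicalPhysics.QuantumFieldTheory.BalabanImbrieJaffe1984to88.BIJ85Eq453GaugeField (qsstarGIter0)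
open B15AveragingHolomorphic (iterMh)
open B15SU2ChartHolomorphic (expMulC logCoordC)
open B15ShellGauge193 (shellGauge)
open B15Extension193 (extend)
open B16Sect1Backgrounds (toMS expMul)
open B15Prop1ChartSU2 (su2Chart)
open Metric (ball)
open B15Prop1ClosedGuardUniformRadius (isCompact_setOf_plaqLeOn)

variable {F : T4Family} {k : ℕ}



/-! ## §1  (J0′) `hMin` at `𝐁_k(Z)` from (E) + the datum's regularity on `Z` + (δ) + (T1@q₀) under ONE announced threshold `δ₀` — the lineage's output shape over V4 §2 -/

/-- ★★★ **(J0′) `hMin` AT THE RECORD's `𝐁_k(Z)` FROM PRINT's PER-BASE-FIELD ROWS, OVER THE LANE's THRESHOLD PRODUCER (V4 §2)** — the siblings' `hMin_atRecord_Bj_of_printLetters_ofClassTower(NearFlat)`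
with EVERY analytic per-base-field letter ((45), `a`, `Φ₀`, (β) ∕ (P), (M)) gone: instance-level the class facts and the forest are discharged by name; per height the radius letter `hsbU` at
`ρ″` with the floor `12(d−1)L·εreg ≤ ρ″`, the datum scale `δ` with `6(d−1)Lᵏ·δ ≤ ρ″`, the right-inverse letter `hHB` at `(εH, B)` with `εreg ≤ εH`, `0 ≤ B`; ANNOUNCED `∃ δ₀ > 0`; then for
every `0 ≤ δc ≤ δ₀` and per base field `V_k ∈ K`: (E) the (2.12) minimiser `U₀`, the datum's regularity `PlaqSmallOn (plaqsInside (pts k Z)) δ (ext V_k)`, (δ) `U₀` bondwise `δc`-flat on the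
plaquettes meeting a bond sourced in `Ω₁(Z)`, (T1@q₀) over the closure of the class ⇒ the (J0′) conclusion verbatim.
[cite: Balaban1985Variational, Thm 1 p.279, (7) p.278, Sect. C (44)–(48) p.285, (81)–(83) p.290, Sect. G pp.305–307; Balaban1989LargeFieldI, (1.74) p.192, Prop. 1 p.194; Balaban1989LargeFieldII, p.357, (1.7)–(1.9) p.358, (1.12)–(1.13) p.359; Balaban1988Convergent, (2.2) p.255, (2.10)–(2.13) pp.256–257; Balaban1985Averaging, (122)–(126) p.36; Balaban1987RG1, (0.4) p.253] -/
theorem hMin_atRecord_Bj_of_printLetters_ofClassThreshold (ν : Node00.Stage7Numerics) (Kt : ℕ) (hd3 : 3 ≤ (F.P Kt).d) (Z : Set (Site (F.P Kt) 0))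
    (Λ : Set (Site (F.P Kt) k)) (lo hi : Fin (F.P Kt).d → ℤ) (hkK : k + 1 ≤ (F.P Kt).m + (F.P Kt).K) (hk1 : 1 ≤ k)
    (hdiv : side (F.P Kt).L ν.M₁ k ∣ (F.P Kt).sitesPerDir 0) (hfloor : ((F.P Kt).d + 14) * (F.P Kt).L ≤ ν.M₁) (hZblk : IsBlockUnion k Z) (hε : 0 < ν.εreg)
    (hα3 : (143 * (((((F.P Kt).d + 4 : ℕ) : ℝ)) ^ 2 / 4) ^ 2) * (2 * ((F.P Kt).L : ℝ) ^ 2 * ν.εreg) ≤ 1 / 3)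
    (hα2 : 2 * (2 * ((F.P Kt).L : ℝ) ^ 2 * ν.εreg) ≤ 2 * deltaSU (Fin 2) / ((((F.P Kt).d + 4) * (F.P Kt).L : ℕ) : ℝ) ^ 2)
    -- the per-HEIGHT letters (all EXISTENCE constants per (instance, height), inhabited by dag-n12-w6's `N12HsurjOfClass.exists_hsurjLetters`): the radius letter `hsbU` at `ρ″` with the
    -- volume-free floor `12(d−1)L·εreg ≤ ρ″`; the datum's regularity scale `δ` with its tower-box budget `6(d−1)Lᵏ·δ ≤ ρ″`; the right-inverse letter `hHB` at `(εH, B)`, `εreg ≤ εH`, `0 ≤ B`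
    {ρ'' : ℝ} (hsbU : ∀ W : GaugeField (F.P Kt) 0 SU2, ‖coeField W - 1‖ ≤ ρ'' → SmallBelow (Node00.avOfRecord F 2 Kt) k W)
    (hερ : 12 * ((((F.P Kt).d - 1 : ℕ)) : ℝ) * (F.P Kt).L * ν.εreg ≤ ρ'') {δ : ℝ} (hδ : 0 < δ) (hδρ : 6 * ((((F.P Kt).d - 1 : ℕ)) : ℝ) * (F.P Kt).L ^ k * δ ≤ ρ'')
    {εH B : ℝ}
    (hHB : ∀ (Wd : MSField (F.P Kt) SU2) (U₀ : GaugeField (F.P Kt) 0 SU2),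
      AgreeOn (Bj ν.M₁ Z k) (avgFamily (avOfRecord F 2 Kt) U₀) Wd →
      (∀ i' : Fin (constrCard (Bj ν.M₁ Z k) k), ∃ U' : GaugeField (F.P Kt) 0 SU2,
        (∀ b ∈ feeds (((constrEnum (Bj ν.M₁ Z k) k).symm i').1 : ℕ) ((constrEnum (Bj ν.M₁ Z k) k).symm i').2.1, U' b = U₀ b) ∧
          SmallBelow (avOfRecord F 2 Kt) k U') →
      (∀ (j : ℕ), 1 ≤ j → j ≤ k → ∀ y : Site (F.P Kt) j, embIter j y ∈ maxDomT ν.M₁ Z j → ∃ U' : GaugeField (F.P Kt) 0 SU2,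
        (∀ c : PBond (F.P Kt) j, (c.src = y ∨ c.tgt = y) → ∀ b₀ : PBond (F.P Kt) 0,
          (iterBlockOf j b₀.src = c.src ∨ iterBlockOf j b₀.src = c.tgt) → (iterBlockOf j b₀.tgt = c.src ∨ iterBlockOf j b₀.tgt = c.tgt) → U' b₀ = U₀ b₀) ∧
        SmallBelow (avOfRecord F 2 Kt) k U') →
      (∀ (j : ℕ), 1 ≤ j → j ≤ k → ∀ y : Site (F.P Kt) j, embIter j y ∈ maxDomT ν.M₁ Z j →
        PlaqSmallOn (boxPlaqs (fun κ => lift (F.P Kt) (embIter j y) κ - ((((F.P Kt).L ^ j : ℕ) : ℤ) + ((((F.P Kt).L ^ j - 1) / 2 : ℕ) : ℤ)))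
          (fun κ => lift (F.P Kt) (embIter j y) κ + ((((F.P Kt).L ^ j : ℕ) : ℤ) + ((((F.P Kt).L ^ j - 1) / 2 : ℕ) : ℤ))) : Set (Plaq (F.P Kt) 0)) εH U₀) →
      ∃ H : (Fin (constrCard (Bj ν.M₁ Z k) k) → lieSU (Fin 2)) → PBond (F.P Kt) 0 → lieSU (Fin 2),
        (∀ v, fderiv ℝ (msChart F 2 Kt k (Bj ν.M₁ Z k) Wd U₀) 0 (H v) = v) ∧ ∀ v, Real.sqrt (∑ b, ‖H v b‖ ^ 2) ≤ B * ‖v‖)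
    (hεH : ν.εreg ≤ εH) (hB0 : 0 ≤ B)
    (ext : GaugeField (F.P Kt) k SU2 → GaugeField (F.P Kt) k SU2) (hext : ∀ W, ext W = extend Λ (shellGauge W lo hi) W)
    {K : Set (GaugeField (F.P Kt) k SU2)} (hK : IsCompact K) {𝓐₀ : ℝ} (h𝓐₀ : 1 < 𝓐₀) :
    -- THE GAUGE-TOLERANCE THRESHOLD `δ₀`, announced before the base fields (V4: it absorbs the flat coercivity, the (L) constant and radius, the preimage letter and the chart curvature)
    ∃ δ₀ : ℝ, 0 < δ₀ ∧
    ∀ {δc : ℝ}, 0 ≤ δc → δc ≤ δ₀ →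
    (∀ Vk ∈ K, ∃ U₀ : GaugeField (F.P Kt) 0 SU2,
      IsMinimizer (Node00.avOfRecord F 2 Kt) (Node00.regMSCoPOfRecord F 2 ν Kt k (maxDomT ν.M₁ Z)) (Bj ν.M₁ Z k)
        (avgFamily (Node00.avOfRecord F 2 Kt) (qsstarGIter0 k (ext Vk))) U₀ ∧
      -- the DATUM's scale-`k` regularity on `Z` (the p. 193 extension `Ṽ_k = ext V_k`; the road's `B15ShellGauge193Local.dist1_plaqHol_extend_shellGauge_le`)
      PlaqSmallOn (plaqsInside (pts k Z)) δ (ext Vk) ∧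
      -- (δ) DISPLAYED — THE ONE GAUGE letter (the direct road's (N)-package clause): `U₀` bondwise `δc`-flat on the plaquettes meeting a bond sourced in `Ω₁(Z)`; the tower-flatness row (δ_T) and the multiplier row (M) of p717767 FOLLOW (`B15Prop1TowerFlatOfNearFlat`; dag-n12-w6's `…N12MultiplierLetterOfClass` + the lane's `…N12SliceDatumCurvatureOfClass`)
      (∀ q : Plaq (F.P Kt) 0, ((⟨q.src, q.μ⟩ : PBond (F.P Kt) 0) ∈ {b : PBond (F.P Kt) 0 | b.src ∈ maxDomT ν.M₁ Z 1} ∨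
          (⟨q.src.shift q.μ, q.ν⟩ : PBond (F.P Kt) 0) ∈ {b : PBond (F.P Kt) 0 | b.src ∈ maxDomT ν.M₁ Z 1} ∨
          (⟨q.src.shift q.ν, q.μ⟩ : PBond (F.P Kt) 0) ∈ {b : PBond (F.P Kt) 0 | b.src ∈ maxDomT ν.M₁ Z 1} ∨
          (⟨q.src, q.ν⟩ : PBond (F.P Kt) 0) ∈ {b : PBond (F.P Kt) 0 | b.src ∈ maxDomT ν.M₁ Z 1}) →
        ‖((U₀ ⟨q.src, q.μ⟩ : SU2) : Matrix (Fin 2) (Fin 2) ℂ) - 1‖ ≤ δc ∧ ‖((U₀ ⟨q.src.shift q.μ, q.ν⟩ : SU2) : Matrix (Fin 2) (Fin 2) ℂ) - 1‖ ≤ δc ∧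
          ‖((U₀ ⟨q.src.shift q.ν, q.μ⟩ : SU2) : Matrix (Fin 2) (Fin 2) ℂ) - 1‖ ≤ δc ∧ ‖((U₀ ⟨q.src, q.ν⟩ : SU2) : Matrix (Fin 2) (Fin 2) ℂ) - 1‖ ≤ δc) ∧
      -- (T1@q₀) — the capstone's row verbatim
      (∀ U ∈ closure (Node00.regMSCoPOfRecord F 2 ν Kt k (maxDomT ν.M₁ Z)),
        AgreeOn (Bj ν.M₁ Z k) (avgFamily (Node00.avOfRecord F 2 Kt) U) (avgFamily (Node00.avOfRecord F 2 Kt) (qsstarGIter0 k (ext Vk))) →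
        wilsonAction4 U ≤ wilsonAction4 U₀ →
          ∃ u : GaugeTransf (F.P Kt) 0 SU2, (∀ j, j ≤ k → ∀ b ∈ bondsOf (Bj ν.M₁ Z k j), toMS u j b.src = toMS u j b.tgt ∧ ∀ g : SU2, toMS u j b.src * g = g * toMS u j b.src) ∧ gaugeAct u U = U₀)) →
    ∃ R : ℝ, 0 < R ∧ ∀ Vk ∈ K,
      ∃ Ũ : VecField (F.P Kt) k (EuclideanSpace ℂ (Fin 3)) × VecField (F.P Kt) k (EuclideanSpace ℂ (Fin 3)) → PBond (F.P Kt) 0 → Matrix (Fin 2) (Fin 2) ℂ,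
        (∀ b i j, DifferentiableOn ℂ (fun z => Ũ z b i j) (ball 0 R)) ∧
        (∀ z ∈ ball (0 : VecField (F.P Kt) k (EuclideanSpace ℂ (Fin 3)) × VecField (F.P Kt) k (EuclideanSpace ℂ (Fin 3))) R, ∀ b i j, ‖Ũ z b i j‖ ≤ 𝓐₀) ∧
        ∀ p B' : VecField (F.P Kt) k E3, ‖p‖ < R → ‖B'‖ < R → ∃ U' : GaugeField (F.P Kt) 0 SU2,
          (∀ b, Ũ (cplxVec p, cplxVec B') b = ((U' b : SU2) : Matrix (Fin 2) (Fin 2) ℂ)) ∧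
            IsMinimizer (Node00.avOfRecord F 2 Kt) (Node00.regMSCoPOfRecord F 2 ν Kt k (maxDomT ν.M₁ Z)) (Bj ν.M₁ Z k)
              (avgFamily (Node00.avOfRecord F 2 Kt) (qsstarGIter0 k (expMul su2Chart B' (ext (expMul su2Chart p Vk))))) U' := by
  have hk : k ≤ (F.P Kt).m + (F.P Kt).K := Nat.le_of_succ_le hkK
  have hM4 : 4 * (F.P Kt).L ≤ ν.M₁ := le_trans (Nat.mul_le_mul_right _ (by omega)) hfloor
  have hM : 1 ≤ ν.M₁ := le_trans (Nat.succ_le_of_lt (Nat.mul_pos (Nat.succ_pos _) (F.P Kt).L_pos)) hfloor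
  have hd2 : 2 ≤ (F.P Kt).d := le_trans (by norm_num) hd3
  -- `0 < ρ″` from the floor (V4 displays it; here `εreg > 0`, `d ≥ 3`, `L ≥ 1`)
  have hρ : 0 < ρ'' := by
    have h1 : (0 : ℝ) < ((((F.P Kt).d - 1 : ℕ)) : ℝ) := by exact_mod_cast (show 0 < (F.P Kt).d - 1 by omega)
    have h2 : (0 : ℝ) < ((F.P Kt).L : ℝ) := by exact_mod_cast (F.P Kt).L_pos
    have h3 : (0 : ℝ) < 12 * ((((F.P Kt).d - 1 : ℕ)) : ℝ) * (F.P Kt).L * ν.εreg := mul_pos (mul_pos (mul_pos (by norm_num) h1) h2) hε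
    exact lt_of_lt_of_le h3 hερ
  -- the class facts (dag-n12-w1 g4) and ONE forest with its axial slice (dag-n12-w3), by name
  obtain ⟨hreg', hcl, hDreg'⟩ :=
    classLetters_closure_regMSCoPOfRecord_Bj (F := F) (N := 2) (K := Kt) ν hε hk hdiv hfloor Z k (Nat.le_succ k) hα3 hα2
  obtain ⟨path, S, hF1, hF2, hTREE, hF3, -⟩ := exists_forest_slice_Bj (P := F.P Kt) (M₁ := ν.M₁) (Z := Z) hk hk1 hM hdiv
  exact hMin_atRecord_of_node00Letters_thm1AtBase_central_ofClass_threshold ν Kt hd2 Z Λ lo hi (Bj ν.M₁ Z k) rfl hkK hM4 hdiv hZblk hε.le hsbU hρ hερ hδ hδρ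
    ext hext hK h𝓐₀ (closure (Node00.regMSCoPOfRecord F 2 ν Kt k (maxDomT ν.M₁ Z))) hreg' hcl hDreg' hk1 hHB hεH hB0 path S hF1 hF2 hTREE hF3


/-! ## §2  The same with the gauge row asked of a RESIDUAL re-gauging `U₀^σ` — over V4 §3, the (σ)_N producer's output shape -/

/-- ★★★ **THE SAME IN RESIDUAL-GAUGE FORM (V4 §3)**: per base field the consumer supplies the minimiser `U₀`, the datum's regularity, a RESIDUAL gauge `σ` (scale-`j` images `1` at both ends
of every constrained bond of `𝐁_k(Z)`), the (δ) row for `U₀^σ`, and (T1@q₀) for `U₀` — exactly the output shape of dag-n12-w3's (σ)_N producer at the record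
(`N12GaugeLetterLocOfClass.exists_gaugeLetterLoc_atRecord_of_class`); class facts, forest, `0 < ρ″` discharged as in §1.
[cite: Balaban1985Variational, Thm 1 p.279, (3)–(4) p.278, (181) p.307; Balaban1989LargeFieldI, (1.74) p.192, Prop. 1 p.194; Balaban1989LargeFieldII, p.357, (1.12)–(1.13) p.359; Balaban1988Convergent, (2.10)–(2.13) pp.256–257; Balaban1987RG1, (0.4) p.253] -/
theorem hMin_atRecord_Bj_of_printLetters_ofClassThreshold_residual (ν : Node00.Stage7Numerics) (Kt : ℕ) (hd3 : 3 ≤ (F.P Kt).d) (Z : Set (Site (F.P Kt) 0))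
    (Λ : Set (Site (F.P Kt) k)) (lo hi : Fin (F.P Kt).d → ℤ) (hkK : k + 1 ≤ (F.P Kt).m + (F.P Kt).K) (hk1 : 1 ≤ k)
    (hdiv : side (F.P Kt).L ν.M₁ k ∣ (F.P Kt).sitesPerDir 0) (hfloor : ((F.P Kt).d + 14) * (F.P Kt).L ≤ ν.M₁) (hZblk : IsBlockUnion k Z) (hε : 0 < ν.εreg)
    (hα3 : (143 * (((((F.P Kt).d + 4 : ℕ) : ℝ)) ^ 2 / 4) ^ 2) * (2 * ((F.P Kt).L : ℝ) ^ 2 * ν.εreg) ≤ 1 / 3)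
    (hα2 : 2 * (2 * ((F.P Kt).L : ℝ) ^ 2 * ν.εreg) ≤ 2 * deltaSU (Fin 2) / ((((F.P Kt).d + 4) * (F.P Kt).L : ℕ) : ℝ) ^ 2)
    -- the per-HEIGHT letters (all EXISTENCE constants per (instance, height), inhabited by dag-n12-w6's `N12HsurjOfClass.exists_hsurjLetters`): the radius letter `hsbU` at `ρ″` with the
    -- volume-free floor `12(d−1)L·εreg ≤ ρ″`; the datum's regularity scale `δ` with its tower-box budget `6(d−1)Lᵏ·δ ≤ ρ″`; the right-inverse letter `hHB` at `(εH, B)`, `εreg ≤ εH`, `0 ≤ B`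
    {ρ'' : ℝ} (hsbU : ∀ W : GaugeField (F.P Kt) 0 SU2, ‖coeField W - 1‖ ≤ ρ'' → SmallBelow (Node00.avOfRecord F 2 Kt) k W)
    (hερ : 12 * ((((F.P Kt).d - 1 : ℕ)) : ℝ) * (F.P Kt).L * ν.εreg ≤ ρ'') {δ : ℝ} (hδ : 0 < δ) (hδρ : 6 * ((((F.P Kt).d - 1 : ℕ)) : ℝ) * (F.P Kt).L ^ k * δ ≤ ρ'')
    {εH B : ℝ}
    (hHB : ∀ (Wd : MSField (F.P Kt) SU2) (U₀ : GaugeField (F.P Kt) 0 SU2),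
      AgreeOn (Bj ν.M₁ Z k) (avgFamily (avOfRecord F 2 Kt) U₀) Wd →
      (∀ i' : Fin (constrCard (Bj ν.M₁ Z k) k), ∃ U' : GaugeField (F.P Kt) 0 SU2,
        (∀ b ∈ feeds (((constrEnum (Bj ν.M₁ Z k) k).symm i').1 : ℕ) ((constrEnum (Bj ν.M₁ Z k) k).symm i').2.1, U' b = U₀ b) ∧
          SmallBelow (avOfRecord F 2 Kt) k U') →
      (∀ (j : ℕ), 1 ≤ j → j ≤ k → ∀ y : Site (F.P Kt) j, embIter j y ∈ maxDomT ν.M₁ Z j → ∃ U' : GaugeField (F.P Kt) 0 SU2,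
        (∀ c : PBond (F.P Kt) j, (c.src = y ∨ c.tgt = y) → ∀ b₀ : PBond (F.P Kt) 0,
          (iterBlockOf j b₀.src = c.src ∨ iterBlockOf j b₀.src = c.tgt) → (iterBlockOf j b₀.tgt = c.src ∨ iterBlockOf j b₀.tgt = c.tgt) → U' b₀ = U₀ b₀) ∧
        SmallBelow (avOfRecord F 2 Kt) k U') →
      (∀ (j : ℕ), 1 ≤ j → j ≤ k → ∀ y : Site (F.P Kt) j, embIter j y ∈ maxDomT ν.M₁ Z j →
        PlaqSmallOn (boxPlaqs (fun κ => lift (F.P Kt) (embIter j y) κ - ((((F.P Kt).L ^ j : ℕ) : ℤ) + ((((F.P Kt).L ^ j - 1) / 2 : ℕ) : ℤ)))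
          (fun κ => lift (F.P Kt) (embIter j y) κ + ((((F.P Kt).L ^ j : ℕ) : ℤ) + ((((F.P Kt).L ^ j - 1) / 2 : ℕ) : ℤ))) : Set (Plaq (F.P Kt) 0)) εH U₀) →
      ∃ H : (Fin (constrCard (Bj ν.M₁ Z k) k) → lieSU (Fin 2)) → PBond (F.P Kt) 0 → lieSU (Fin 2),
        (∀ v, fderiv ℝ (msChart F 2 Kt k (Bj ν.M₁ Z k) Wd U₀) 0 (H v) = v) ∧ ∀ v, Real.sqrt (∑ b, ‖H v b‖ ^ 2) ≤ B * ‖v‖)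
    (hεH : ν.εreg ≤ εH) (hB0 : 0 ≤ B)
    (ext : GaugeField (F.P Kt) k SU2 → GaugeField (F.P Kt) k SU2) (hext : ∀ W, ext W = extend Λ (shellGauge W lo hi) W)
    {K : Set (GaugeField (F.P Kt) k SU2)} (hK : IsCompact K) {𝓐₀ : ℝ} (h𝓐₀ : 1 < 𝓐₀) :
    -- THE GAUGE-TOLERANCE THRESHOLD `δ₀`, announced before the base fields (V4: it absorbs the flat coercivity, the (L) constant and radius, the preimage letter and the chart curvature)
    ∃ δ₀ : ℝ, 0 < δ₀ ∧
    ∀ {δc : ℝ}, 0 ≤ δc → δc ≤ δ₀ →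
    (∀ Vk ∈ K, ∃ (U₀ : GaugeField (F.P Kt) 0 SU2) (σ : GaugeTransf (F.P Kt) 0 SU2),
      IsMinimizer (Node00.avOfRecord F 2 Kt) (Node00.regMSCoPOfRecord F 2 ν Kt k (maxDomT ν.M₁ Z)) (Bj ν.M₁ Z k)
        (avgFamily (Node00.avOfRecord F 2 Kt) (qsstarGIter0 k (ext Vk))) U₀ ∧
      -- the DATUM's scale-`k` regularity on `Z` (the p. 193 extension `Ṽ_k = ext V_k`; the road's `B15ShellGauge193Local.dist1_plaqHol_extend_shellGauge_le`)
      PlaqSmallOn (plaqsInside (pts k Z)) δ (ext Vk) ∧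
      -- a RESIDUAL gauge `σ` (scale-`j` images `1` at both ends of every constrained bond — dag-n12-w3's (σ)_N producer's shape) …
      (∀ j, j ≤ k → ∀ b ∈ bondsOf (Bj ν.M₁ Z k j), toMS σ j b.src = 1 ∧ toMS σ j b.tgt = 1) ∧
      -- … in which (δ) holds: `U₀^σ` bondwise `δc`-flat on the plaquettes meeting a bond sourced in `Ω₁(Z)`; the tower-flatness row (δ_T) and the multiplier row (M) of p717767 FOLLOW (`B15Prop1TowerFlatOfNearFlat`; dag-n12-w6's `…N12MultiplierLetterOfClass` + the lane's `…N12SliceDatumCurvatureOfClass`)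
      (∀ q : Plaq (F.P Kt) 0, ((⟨q.src, q.μ⟩ : PBond (F.P Kt) 0) ∈ {b : PBond (F.P Kt) 0 | b.src ∈ maxDomT ν.M₁ Z 1} ∨
          (⟨q.src.shift q.μ, q.ν⟩ : PBond (F.P Kt) 0) ∈ {b : PBond (F.P Kt) 0 | b.src ∈ maxDomT ν.M₁ Z 1} ∨
          (⟨q.src.shift q.ν, q.μ⟩ : PBond (F.P Kt) 0) ∈ {b : PBond (F.P Kt) 0 | b.src ∈ maxDomT ν.M₁ Z 1} ∨
          (⟨q.src, q.ν⟩ : PBond (F.P Kt) 0) ∈ {b : PBond (F.P Kt) 0 | b.src ∈ maxDomT ν.M₁ Z 1}) →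
        ‖((gaugeAct σ U₀ ⟨q.src, q.μ⟩ : SU2) : Matrix (Fin 2) (Fin 2) ℂ) - 1‖ ≤ δc ∧ ‖((gaugeAct σ U₀ ⟨q.src.shift q.μ, q.ν⟩ : SU2) : Matrix (Fin 2) (Fin 2) ℂ) - 1‖ ≤ δc ∧
          ‖((gaugeAct σ U₀ ⟨q.src.shift q.ν, q.μ⟩ : SU2) : Matrix (Fin 2) (Fin 2) ℂ) - 1‖ ≤ δc ∧ ‖((gaugeAct σ U₀ ⟨q.src, q.ν⟩ : SU2) : Matrix (Fin 2) (Fin 2) ℂ) - 1‖ ≤ δc) ∧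
      -- (T1@q₀) — the capstone's row verbatim
      (∀ U ∈ closure (Node00.regMSCoPOfRecord F 2 ν Kt k (maxDomT ν.M₁ Z)),
        AgreeOn (Bj ν.M₁ Z k) (avgFamily (Node00.avOfRecord F 2 Kt) U) (avgFamily (Node00.avOfRecord F 2 Kt) (qsstarGIter0 k (ext Vk))) →
        wilsonAction4 U ≤ wilsonAction4 U₀ →
          ∃ u : GaugeTransf (F.P Kt) 0 SU2, (∀ j, j ≤ k → ∀ b ∈ bondsOf (Bj ν.M₁ Z k j), toMS u j b.src = toMS u j b.tgt ∧ ∀ g : SU2, toMS u j b.src * g = g * toMS u j b.src) ∧ gaugeAct u U = U₀)) →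
    ∃ R : ℝ, 0 < R ∧ ∀ Vk ∈ K,
      ∃ Ũ : VecField (F.P Kt) k (EuclideanSpace ℂ (Fin 3)) × VecField (F.P Kt) k (EuclideanSpace ℂ (Fin 3)) → PBond (F.P Kt) 0 → Matrix (Fin 2) (Fin 2) ℂ,
        (∀ b i j, DifferentiableOn ℂ (fun z => Ũ z b i j) (ball 0 R)) ∧
        (∀ z ∈ ball (0 : VecField (F.P Kt) k (EuclideanSpace ℂ (Fin 3)) × VecField (F.P Kt) k (EuclideanSpace ℂ (Fin 3))) R, ∀ b i j, ‖Ũ z b i j‖ ≤ 𝓐₀) ∧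
        ∀ p B' : VecField (F.P Kt) k E3, ‖p‖ < R → ‖B'‖ < R → ∃ U' : GaugeField (F.P Kt) 0 SU2,
          (∀ b, Ũ (cplxVec p, cplxVec B') b = ((U' b : SU2) : Matrix (Fin 2) (Fin 2) ℂ)) ∧
            IsMinimizer (Node00.avOfRecord F 2 Kt) (Node00.regMSCoPOfRecord F 2 ν Kt k (maxDomT ν.M₁ Z)) (Bj ν.M₁ Z k)
              (avgFamily (Node00.avOfRecord F 2 Kt) (qsstarGIter0 k (expMul su2Chart B' (ext (expMul su2Chart p Vk))))) U' := by
  have hk : k ≤ (F.P Kt).m + (F.P Kt).K := Nat.le_of_succ_le hkK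
  have hM4 : 4 * (F.P Kt).L ≤ ν.M₁ := le_trans (Nat.mul_le_mul_right _ (by omega)) hfloor
  have hM : 1 ≤ ν.M₁ := le_trans (Nat.succ_le_of_lt (Nat.mul_pos (Nat.succ_pos _) (F.P Kt).L_pos)) hfloor
  have hd2 : 2 ≤ (F.P Kt).d := le_trans (by norm_num) hd3
  -- `0 < ρ″` from the floor (V4 displays it; here `εreg > 0`, `d ≥ 3`, `L ≥ 1`)
  have hρ : 0 < ρ'' := by
    have h1 : (0 : ℝ) < ((((F.P Kt).d - 1 : ℕ)) : ℝ) := by exact_mod_cast (show 0 < (F.P Kt).d - 1 by omega)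
    have h2 : (0 : ℝ) < ((F.P Kt).L : ℝ) := by exact_mod_cast (F.P Kt).L_pos
    have h3 : (0 : ℝ) < 12 * ((((F.P Kt).d - 1 : ℕ)) : ℝ) * (F.P Kt).L * ν.εreg := mul_pos (mul_pos (mul_pos (by norm_num) h1) h2) hε
    exact lt_of_lt_of_le h3 hερ
  -- the class facts (dag-n12-w1 g4) and ONE forest with its axial slice (dag-n12-w3), by name
  obtain ⟨hreg', hcl, hDreg'⟩ :=
    classLetters_closure_regMSCoPOfRecord_Bj (F := F) (N := 2) (K := Kt) ν hε hk hdiv hfloor Z k (Nat.le_succ k) hα3 hα2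
  obtain ⟨path, S, hF1, hF2, hTREE, hF3, -⟩ := exists_forest_slice_Bj (P := F.P Kt) (M₁ := ν.M₁) (Z := Z) hk hk1 hM hdiv
  exact hMin_atRecord_of_node00Letters_thm1AtBase_central_ofClass_threshold_residual ν Kt hd2 Z Λ lo hi (Bj ν.M₁ Z k) rfl hkK hM4 hdiv hZblk hε.le hsbU hρ hερ hδ hδρ
    ext hext hK h𝓐₀ (closure (Node00.regMSCoPOfRecord F 2 ν Kt k (maxDomT ν.M₁ Z))) hreg' hcl hDreg' hk1 hHB hεH hB0 path S hF1 hF2 hTREE hF3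


/-! ## §3  §1 read once on the (compact) CLOSED small-field guard — the shape the knit-row junction consumes -/

/-- ★★★ **§1 ON THE CLOSED GUARD `{∀ p ∈ G, |V_k(∂p) − 1| ≤ eR}` (any `G`, any `eR`)**: the guard is itself compact (`B15Prop1ClosedGuardUniformRadius.isCompact_setOf_plaqLeOn`), so §1 at
`K :=` the guard gives, after the announced `δ₀`, ONE radius `R` for every guarded base field — the shape `N12MinimiserFamilyKnitRowThreshold` consumes at `G := plaqsInside (pts k (Z ∩ Λᶜ))`.
One term over §1.
[cite: Balaban1989LargeFieldI, (1.74) p.192, Prop. 1 p.194 (last clause); Balaban1985Variational, Thm 1 p.279, (7) p.278, Prop. 9 (190) p.309; Balaban1988Convergent, (2.12)–(2.13) pp.256–257] -/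
theorem hMin_closedGuard_atRecord_Bj_of_printLetters_ofClassThreshold (ν : Node00.Stage7Numerics) (Kt : ℕ) (hd3 : 3 ≤ (F.P Kt).d) (Z : Set (Site (F.P Kt) 0))
    (Λ : Set (Site (F.P Kt) k)) (lo hi : Fin (F.P Kt).d → ℤ) (hkK : k + 1 ≤ (F.P Kt).m + (F.P Kt).K) (hk1 : 1 ≤ k)
    (hdiv : side (F.P Kt).L ν.M₁ k ∣ (F.P Kt).sitesPerDir 0) (hfloor : ((F.P Kt).d + 14) * (F.P Kt).L ≤ ν.M₁) (hZblk : IsBlockUnion k Z) (hε : 0 < ν.εreg)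
    (hα3 : (143 * (((((F.P Kt).d + 4 : ℕ) : ℝ)) ^ 2 / 4) ^ 2) * (2 * ((F.P Kt).L : ℝ) ^ 2 * ν.εreg) ≤ 1 / 3)
    (hα2 : 2 * (2 * ((F.P Kt).L : ℝ) ^ 2 * ν.εreg) ≤ 2 * deltaSU (Fin 2) / ((((F.P Kt).d + 4) * (F.P Kt).L : ℕ) : ℝ) ^ 2)
    -- the per-HEIGHT letters (all EXISTENCE constants per (instance, height), inhabited by dag-n12-w6's `N12HsurjOfClass.exists_hsurjLetters`): the radius letter `hsbU` at `ρ″` with the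
    -- volume-free floor `12(d−1)L·εreg ≤ ρ″`; the datum's regularity scale `δ` with its tower-box budget `6(d−1)Lᵏ·δ ≤ ρ″`; the right-inverse letter `hHB` at `(εH, B)`, `εreg ≤ εH`, `0 ≤ B`
    {ρ'' : ℝ} (hsbU : ∀ W : GaugeField (F.P Kt) 0 SU2, ‖coeField W - 1‖ ≤ ρ'' → SmallBelow (Node00.avOfRecord F 2 Kt) k W)
    (hερ : 12 * ((((F.P Kt).d - 1 : ℕ)) : ℝ) * (F.P Kt).L * ν.εreg ≤ ρ'') {δ : ℝ} (hδ : 0 < δ) (hδρ : 6 * ((((F.P Kt).d - 1 : ℕ)) : ℝ) * (F.P Kt).L ^ k * δ ≤ ρ'')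
    {εH B : ℝ}
    (hHB : ∀ (Wd : MSField (F.P Kt) SU2) (U₀ : GaugeField (F.P Kt) 0 SU2),
      AgreeOn (Bj ν.M₁ Z k) (avgFamily (avOfRecord F 2 Kt) U₀) Wd →
      (∀ i' : Fin (constrCard (Bj ν.M₁ Z k) k), ∃ U' : GaugeField (F.P Kt) 0 SU2,
        (∀ b ∈ feeds (((constrEnum (Bj ν.M₁ Z k) k).symm i').1 : ℕ) ((constrEnum (Bj ν.M₁ Z k) k).symm i').2.1, U' b = U₀ b) ∧
          SmallBelow (avOfRecord F 2 Kt) k U') →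
      (∀ (j : ℕ), 1 ≤ j → j ≤ k → ∀ y : Site (F.P Kt) j, embIter j y ∈ maxDomT ν.M₁ Z j → ∃ U' : GaugeField (F.P Kt) 0 SU2,
        (∀ c : PBond (F.P Kt) j, (c.src = y ∨ c.tgt = y) → ∀ b₀ : PBond (F.P Kt) 0,
          (iterBlockOf j b₀.src = c.src ∨ iterBlockOf j b₀.src = c.tgt) → (iterBlockOf j b₀.tgt = c.src ∨ iterBlockOf j b₀.tgt = c.tgt) → U' b₀ = U₀ b₀) ∧
        SmallBelow (avOfRecord F 2 Kt) k U') →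
      (∀ (j : ℕ), 1 ≤ j → j ≤ k → ∀ y : Site (F.P Kt) j, embIter j y ∈ maxDomT ν.M₁ Z j →
        PlaqSmallOn (boxPlaqs (fun κ => lift (F.P Kt) (embIter j y) κ - ((((F.P Kt).L ^ j : ℕ) : ℤ) + ((((F.P Kt).L ^ j - 1) / 2 : ℕ) : ℤ)))
          (fun κ => lift (F.P Kt) (embIter j y) κ + ((((F.P Kt).L ^ j : ℕ) : ℤ) + ((((F.P Kt).L ^ j - 1) / 2 : ℕ) : ℤ))) : Set (Plaq (F.P Kt) 0)) εH U₀) →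
      ∃ H : (Fin (constrCard (Bj ν.M₁ Z k) k) → lieSU (Fin 2)) → PBond (F.P Kt) 0 → lieSU (Fin 2),
        (∀ v, fderiv ℝ (msChart F 2 Kt k (Bj ν.M₁ Z k) Wd U₀) 0 (H v) = v) ∧ ∀ v, Real.sqrt (∑ b, ‖H v b‖ ^ 2) ≤ B * ‖v‖)
    (hεH : ν.εreg ≤ εH) (hB0 : 0 ≤ B)
    (ext : GaugeField (F.P Kt) k SU2 → GaugeField (F.P Kt) k SU2) (hext : ∀ W, ext W = extend Λ (shellGauge W lo hi) W)
    (G : Set (Plaq (F.P Kt) k)) (eR : ℝ) {𝓐₀ : ℝ} (h𝓐₀ : 1 < 𝓐₀) :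
    -- THE GAUGE-TOLERANCE THRESHOLD `δ₀`, announced before the base fields (V4: it absorbs the flat coercivity, the (L) constant and radius, the preimage letter and the chart curvature)
    ∃ δ₀ : ℝ, 0 < δ₀ ∧
    ∀ {δc : ℝ}, 0 ≤ δc → δc ≤ δ₀ →
    (∀ Vk : GaugeField (F.P Kt) k SU2, (∀ p ∈ G, dist1 (GaugeField.plaqHol Vk p) ≤ eR) → ∃ U₀ : GaugeField (F.P Kt) 0 SU2,
      IsMinimizer (Node00.avOfRecord F 2 Kt) (Node00.regMSCoPOfRecord F 2 ν Kt k (maxDomT ν.M₁ Z)) (Bj ν.M₁ Z k)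
        (avgFamily (Node00.avOfRecord F 2 Kt) (qsstarGIter0 k (ext Vk))) U₀ ∧
      -- the DATUM's scale-`k` regularity on `Z` (the p. 193 extension `Ṽ_k = ext V_k`; the road's `B15ShellGauge193Local.dist1_plaqHol_extend_shellGauge_le`)
      PlaqSmallOn (plaqsInside (pts k Z)) δ (ext Vk) ∧
      -- (δ) DISPLAYED — THE ONE GAUGE letter (the direct road's (N)-package clause): `U₀` bondwise `δc`-flat on the plaquettes meeting a bond sourced in `Ω₁(Z)`; the tower-flatness row (δ_T) and the multiplier row (M) of p717767 FOLLOW (`B15Prop1TowerFlatOfNearFlat`; dag-n12-w6's `…N12MultiplierLetterOfClass` + the lane's `…N12SliceDatumCurvatureOfClass`)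
      (∀ q : Plaq (F.P Kt) 0, ((⟨q.src, q.μ⟩ : PBond (F.P Kt) 0) ∈ {b : PBond (F.P Kt) 0 | b.src ∈ maxDomT ν.M₁ Z 1} ∨
          (⟨q.src.shift q.μ, q.ν⟩ : PBond (F.P Kt) 0) ∈ {b : PBond (F.P Kt) 0 | b.src ∈ maxDomT ν.M₁ Z 1} ∨
          (⟨q.src.shift q.ν, q.μ⟩ : PBond (F.P Kt) 0) ∈ {b : PBond (F.P Kt) 0 | b.src ∈ maxDomT ν.M₁ Z 1} ∨
          (⟨q.src, q.ν⟩ : PBond (F.P Kt) 0) ∈ {b : PBond (F.P Kt) 0 | b.src ∈ maxDomT ν.M₁ Z 1}) →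
        ‖((U₀ ⟨q.src, q.μ⟩ : SU2) : Matrix (Fin 2) (Fin 2) ℂ) - 1‖ ≤ δc ∧ ‖((U₀ ⟨q.src.shift q.μ, q.ν⟩ : SU2) : Matrix (Fin 2) (Fin 2) ℂ) - 1‖ ≤ δc ∧
          ‖((U₀ ⟨q.src.shift q.ν, q.μ⟩ : SU2) : Matrix (Fin 2) (Fin 2) ℂ) - 1‖ ≤ δc ∧ ‖((U₀ ⟨q.src, q.ν⟩ : SU2) : Matrix (Fin 2) (Fin 2) ℂ) - 1‖ ≤ δc) ∧
      -- (T1@q₀) — the capstone's row verbatim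
      (∀ U ∈ closure (Node00.regMSCoPOfRecord F 2 ν Kt k (maxDomT ν.M₁ Z)),
        AgreeOn (Bj ν.M₁ Z k) (avgFamily (Node00.avOfRecord F 2 Kt) U) (avgFamily (Node00.avOfRecord F 2 Kt) (qsstarGIter0 k (ext Vk))) →
        wilsonAction4 U ≤ wilsonAction4 U₀ →
          ∃ u : GaugeTransf (F.P Kt) 0 SU2, (∀ j, j ≤ k → ∀ b ∈ bondsOf (Bj ν.M₁ Z k j), toMS u j b.src = toMS u j b.tgt ∧ ∀ g : SU2, toMS u j b.src * g = g * toMS u j b.src) ∧ gaugeAct u U = U₀)) →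
    ∃ R : ℝ, 0 < R ∧ ∀ Vk : GaugeField (F.P Kt) k SU2, (∀ p ∈ G, dist1 (GaugeField.plaqHol Vk p) ≤ eR) →
      ∃ Ũ : VecField (F.P Kt) k (EuclideanSpace ℂ (Fin 3)) × VecField (F.P Kt) k (EuclideanSpace ℂ (Fin 3)) → PBond (F.P Kt) 0 → Matrix (Fin 2) (Fin 2) ℂ,
        (∀ b i j, DifferentiableOn ℂ (fun z => Ũ z b i j) (ball 0 R)) ∧
        (∀ z ∈ ball (0 : VecField (F.P Kt) k (EuclideanSpace ℂ (Fin 3)) × VecField (F.P Kt) k (EuclideanSpace ℂ (Fin 3))) R, ∀ b i j, ‖Ũ z b i j‖ ≤ 𝓐₀) ∧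
        ∀ p B' : VecField (F.P Kt) k E3, ‖p‖ < R → ‖B'‖ < R → ∃ U' : GaugeField (F.P Kt) 0 SU2,
          (∀ b, Ũ (cplxVec p, cplxVec B') b = ((U' b : SU2) : Matrix (Fin 2) (Fin 2) ℂ)) ∧
            IsMinimizer (Node00.avOfRecord F 2 Kt) (Node00.regMSCoPOfRecord F 2 ν Kt k (maxDomT ν.M₁ Z)) (Bj ν.M₁ Z k)
              (avgFamily (Node00.avOfRecord F 2 Kt) (qsstarGIter0 k (expMul su2Chart B' (ext (expMul su2Chart p Vk))))) U' :=
  hMin_atRecord_Bj_of_printLetters_ofClassThreshold ν Kt hd3 Z Λ lo hi hkK hk1 hdiv hfloor hZblk hε hα3 hα2 hsbU hερ hδ hδρ hHB hεH hB0 ext hext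
    (isCompact_setOf_plaqLeOn G eR) h𝓐₀


/-! ## §4  §2 read once on the (compact) CLOSED small-field guard — residual-gauge form, the road of record -/

/-- ★★★ **§2 ON THE CLOSED GUARD** (residual-gauge form): as §3 over §2 — after the announced `δ₀`, ONE radius `R` for every base field of the closed guard
`{∀ p ∈ G, |V_k(∂p) − 1| ≤ eR}`, the per-base-field rows being (E), the datum's regularity, (σ residual, (δ) for `U₀^σ`), (T1@q₀).  One term over §2.
[cite: Balaban1989LargeFieldI, (1.74) p.192, Prop. 1 p.194 (last clause); Balaban1985Variational, Thm 1 p.279, (3)–(4) p.278, (181) p.307; Balaban1988Convergent, (2.12)–(2.13) pp.256–257] -/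
theorem hMin_closedGuard_atRecord_Bj_of_printLetters_ofClassThreshold_residual (ν : Node00.Stage7Numerics) (Kt : ℕ) (hd3 : 3 ≤ (F.P Kt).d) (Z : Set (Site (F.P Kt) 0))
    (Λ : Set (Site (F.P Kt) k)) (lo hi : Fin (F.P Kt).d → ℤ) (hkK : k + 1 ≤ (F.P Kt).m + (F.P Kt).K) (hk1 : 1 ≤ k)
    (hdiv : side (F.P Kt).L ν.M₁ k ∣ (F.P Kt).sitesPerDir 0) (hfloor : ((F.P Kt).d + 14) * (F.P Kt).L ≤ ν.M₁) (hZblk : IsBlockUnion k Z) (hε : 0 < ν.εreg)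
    (hα3 : (143 * (((((F.P Kt).d + 4 : ℕ) : ℝ)) ^ 2 / 4) ^ 2) * (2 * ((F.P Kt).L : ℝ) ^ 2 * ν.εreg) ≤ 1 / 3)
    (hα2 : 2 * (2 * ((F.P Kt).L : ℝ) ^ 2 * ν.εreg) ≤ 2 * deltaSU (Fin 2) / ((((F.P Kt).d + 4) * (F.P Kt).L : ℕ) : ℝ) ^ 2)
    -- the per-HEIGHT letters (all EXISTENCE constants per (instance, height), inhabited by dag-n12-w6's `N12HsurjOfClass.exists_hsurjLetters`): the radius letter `hsbU` at `ρ″` with the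
    -- volume-free floor `12(d−1)L·εreg ≤ ρ″`; the datum's regularity scale `δ` with its tower-box budget `6(d−1)Lᵏ·δ ≤ ρ″`; the right-inverse letter `hHB` at `(εH, B)`, `εreg ≤ εH`, `0 ≤ B`
    {ρ'' : ℝ} (hsbU : ∀ W : GaugeField (F.P Kt) 0 SU2, ‖coeField W - 1‖ ≤ ρ'' → SmallBelow (Node00.avOfRecord F 2 Kt) k W)
    (hερ : 12 * ((((F.P Kt).d - 1 : ℕ)) : ℝ) * (F.P Kt).L * ν.εreg ≤ ρ'') {δ : ℝ} (hδ : 0 < δ) (hδρ : 6 * ((((F.P Kt).d - 1 : ℕ)) : ℝ) * (F.P Kt).L ^ k * δ ≤ ρ'')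
    {εH B : ℝ}
    (hHB : ∀ (Wd : MSField (F.P Kt) SU2) (U₀ : GaugeField (F.P Kt) 0 SU2),
      AgreeOn (Bj ν.M₁ Z k) (avgFamily (avOfRecord F 2 Kt) U₀) Wd →
      (∀ i' : Fin (constrCard (Bj ν.M₁ Z k) k), ∃ U' : GaugeField (F.P Kt) 0 SU2,
        (∀ b ∈ feeds (((constrEnum (Bj ν.M₁ Z k) k).symm i').1 : ℕ) ((constrEnum (Bj ν.M₁ Z k) k).symm i').2.1, U' b = U₀ b) ∧
          SmallBelow (avOfRecord F 2 Kt) k U') →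
      (∀ (j : ℕ), 1 ≤ j → j ≤ k → ∀ y : Site (F.P Kt) j, embIter j y ∈ maxDomT ν.M₁ Z j → ∃ U' : GaugeField (F.P Kt) 0 SU2,
        (∀ c : PBond (F.P Kt) j, (c.src = y ∨ c.tgt = y) → ∀ b₀ : PBond (F.P Kt) 0,
          (iterBlockOf j b₀.src = c.src ∨ iterBlockOf j b₀.src = c.tgt) → (iterBlockOf j b₀.tgt = c.src ∨ iterBlockOf j b₀.tgt = c.tgt) → U' b₀ = U₀ b₀) ∧
        SmallBelow (avOfRecord F 2 Kt) k U') →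
      (∀ (j : ℕ), 1 ≤ j → j ≤ k → ∀ y : Site (F.P Kt) j, embIter j y ∈ maxDomT ν.M₁ Z j →
        PlaqSmallOn (boxPlaqs (fun κ => lift (F.P Kt) (embIter j y) κ - ((((F.P Kt).L ^ j : ℕ) : ℤ) + ((((F.P Kt).L ^ j - 1) / 2 : ℕ) : ℤ)))
          (fun κ => lift (F.P Kt) (embIter j y) κ + ((((F.P Kt).L ^ j : ℕ) : ℤ) + ((((F.P Kt).L ^ j - 1) / 2 : ℕ) : ℤ))) : Set (Plaq (F.P Kt) 0)) εH U₀) →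
      ∃ H : (Fin (constrCard (Bj ν.M₁ Z k) k) → lieSU (Fin 2)) → PBond (F.P Kt) 0 → lieSU (Fin 2),
        (∀ v, fderiv ℝ (msChart F 2 Kt k (Bj ν.M₁ Z k) Wd U₀) 0 (H v) = v) ∧ ∀ v, Real.sqrt (∑ b, ‖H v b‖ ^ 2) ≤ B * ‖v‖)
    (hεH : ν.εreg ≤ εH) (hB0 : 0 ≤ B)
    (ext : GaugeField (F.P Kt) k SU2 → GaugeField (F.P Kt) k SU2) (hext : ∀ W, ext W = extend Λ (shellGauge W lo hi) W)
    (G : Set (Plaq (F.P Kt) k)) (eR : ℝ) {𝓐₀ : ℝ} (h𝓐₀ : 1 < 𝓐₀) :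
    -- THE GAUGE-TOLERANCE THRESHOLD `δ₀`, announced before the base fields (V4: it absorbs the flat coercivity, the (L) constant and radius, the preimage letter and the chart curvature)
    ∃ δ₀ : ℝ, 0 < δ₀ ∧
    ∀ {δc : ℝ}, 0 ≤ δc → δc ≤ δ₀ →
    (∀ Vk : GaugeField (F.P Kt) k SU2, (∀ p ∈ G, dist1 (GaugeField.plaqHol Vk p) ≤ eR) → ∃ (U₀ : GaugeField (F.P Kt) 0 SU2) (σ : GaugeTransf (F.P Kt) 0 SU2),
      IsMinimizer (Node00.avOfRecord F 2 Kt) (Node00.regMSCoPOfRecord F 2 ν Kt k (maxDomT ν.M₁ Z)) (Bj ν.M₁ Z k)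
        (avgFamily (Node00.avOfRecord F 2 Kt) (qsstarGIter0 k (ext Vk))) U₀ ∧
      -- the DATUM's scale-`k` regularity on `Z` (the p. 193 extension `Ṽ_k = ext V_k`; the road's `B15ShellGauge193Local.dist1_plaqHol_extend_shellGauge_le`)
      PlaqSmallOn (plaqsInside (pts k Z)) δ (ext Vk) ∧
      -- a RESIDUAL gauge `σ` (scale-`j` images `1` at both ends of every constrained bond — dag-n12-w3's (σ)_N producer's shape) …
      (∀ j, j ≤ k → ∀ b ∈ bondsOf (Bj ν.M₁ Z k j), toMS σ j b.src = 1 ∧ toMS σ j b.tgt = 1) ∧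
      -- … in which (δ) holds: `U₀^σ` bondwise `δc`-flat on the plaquettes meeting a bond sourced in `Ω₁(Z)`; the tower-flatness row (δ_T) and the multiplier row (M) of p717767 FOLLOW (`B15Prop1TowerFlatOfNearFlat`; dag-n12-w6's `…N12MultiplierLetterOfClass` + the lane's `…N12SliceDatumCurvatureOfClass`)
      (∀ q : Plaq (F.P Kt) 0, ((⟨q.src, q.μ⟩ : PBond (F.P Kt) 0) ∈ {b : PBond (F.P Kt) 0 | b.src ∈ maxDomT ν.M₁ Z 1} ∨
          (⟨q.src.shift q.μ, q.ν⟩ : PBond (F.P Kt) 0) ∈ {b : PBond (F.P Kt) 0 | b.src ∈ maxDomT ν.M₁ Z 1} ∨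
          (⟨q.src.shift q.ν, q.μ⟩ : PBond (F.P Kt) 0) ∈ {b : PBond (F.P Kt) 0 | b.src ∈ maxDomT ν.M₁ Z 1} ∨
          (⟨q.src, q.ν⟩ : PBond (F.P Kt) 0) ∈ {b : PBond (F.P Kt) 0 | b.src ∈ maxDomT ν.M₁ Z 1}) →
        ‖((gaugeAct σ U₀ ⟨q.src, q.μ⟩ : SU2) : Matrix (Fin 2) (Fin 2) ℂ) - 1‖ ≤ δc ∧ ‖((gaugeAct σ U₀ ⟨q.src.shift q.μ, q.ν⟩ : SU2) : Matrix (Fin 2) (Fin 2) ℂ) - 1‖ ≤ δc ∧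
          ‖((gaugeAct σ U₀ ⟨q.src.shift q.ν, q.μ⟩ : SU2) : Matrix (Fin 2) (Fin 2) ℂ) - 1‖ ≤ δc ∧ ‖((gaugeAct σ U₀ ⟨q.src, q.ν⟩ : SU2) : Matrix (Fin 2) (Fin 2) ℂ) - 1‖ ≤ δc) ∧
      -- (T1@q₀) — the capstone's row verbatim
      (∀ U ∈ closure (Node00.regMSCoPOfRecord F 2 ν Kt k (maxDomT ν.M₁ Z)),
        AgreeOn (Bj ν.M₁ Z k) (avgFamily (Node00.avOfRecord F 2 Kt) U) (avgFamily (Node00.avOfRecord F 2 Kt) (qsstarGIter0 k (ext Vk))) →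
        wilsonAction4 U ≤ wilsonAction4 U₀ →
          ∃ u : GaugeTransf (F.P Kt) 0 SU2, (∀ j, j ≤ k → ∀ b ∈ bondsOf (Bj ν.M₁ Z k j), toMS u j b.src = toMS u j b.tgt ∧ ∀ g : SU2, toMS u j b.src * g = g * toMS u j b.src) ∧ gaugeAct u U = U₀)) →
    ∃ R : ℝ, 0 < R ∧ ∀ Vk : GaugeField (F.P Kt) k SU2, (∀ p ∈ G, dist1 (GaugeField.plaqHol Vk p) ≤ eR) →
      ∃ Ũ : VecField (F.P Kt) k (EuclideanSpace ℂ (Fin 3)) × VecField (F.P Kt) k (EuclideanSpace ℂ (Fin 3)) → PBond (F.P Kt) 0 → Matrix (Fin 2) (Fin 2) ℂ,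
        (∀ b i j, DifferentiableOn ℂ (fun z => Ũ z b i j) (ball 0 R)) ∧
        (∀ z ∈ ball (0 : VecField (F.P Kt) k (EuclideanSpace ℂ (Fin 3)) × VecField (F.P Kt) k (EuclideanSpace ℂ (Fin 3))) R, ∀ b i j, ‖Ũ z b i j‖ ≤ 𝓐₀) ∧
        ∀ p B' : VecField (F.P Kt) k E3, ‖p‖ < R → ‖B'‖ < R → ∃ U' : GaugeField (F.P Kt) 0 SU2,
          (∀ b, Ũ (cplxVec p, cplxVec B') b = ((U' b : SU2) : Matrix (Fin 2) (Fin 2) ℂ)) ∧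
            IsMinimizer (Node00.avOfRecord F 2 Kt) (Node00.regMSCoPOfRecord F 2 ν Kt k (maxDomT ν.M₁ Z)) (Bj ν.M₁ Z k)
              (avgFamily (Node00.avOfRecord F 2 Kt) (qsstarGIter0 k (expMul su2Chart B' (ext (expMul su2Chart p Vk))))) U' :=
  hMin_atRecord_Bj_of_printLetters_ofClassThreshold_residual ν Kt hd3 Z Λ lo hi hkK hk1 hdiv hfloor hZblk hε hα3 hα2 hsbU hερ hδ hδρ hHB hεH hB0 ext hext
    (isCompact_setOf_plaqLeOn G eR) h𝓐₀

end Summit.QuantumFields.YangMills.BalabanUVNodes.N12MinimiserFamilyAtRecordBjTowerThreshold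

end
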